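import Summits.ResolutionOfSingularities.ResolutionOfSingularities.Theorems.WildQuotientsSummitReductionStubPairOrbitBlowupCentreLocalLemmas
import Literature.AlgebraicGeometry.Resolution.AffineBlowupUniversal
import Literature.AlgebraicGeometry.Resolution.AffineBlowupRegular
import HarnessLib

/-!
# `WildQuotients.SummitReduction` (stmt-ResolutionOfSingularities-16324), line `FramePerfect`, stub O3
# (`stub_pair_orbitNormalFormBlowup_chartsOverCentre`): points of a blow-up of an affine scheme
# and the localisations of the chart rings

Route `ResolutionOfSingularities/WildQuotients`, crux `SummitReduction`; helper file of stub O3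
(the scheme-to-algebra bridge for the model statement NB2: the blow-up `B → Spec M` of the
coefficient-free model is only given up to the universal property). PROVED here:
`chartsOverCentre_blowup_point_chart` — every point `y` of a blow-up `B` of `Spec R` along
`(g₁, …, g_r)` lies on the chart of some `g_j`, and its local ring (as an `R`-algebra,
`StalkOver`) is the localisation of the affine blow-up algebra `R[I/g_j]` at a prime `𝔮`,
maximal when `y` is closed: uniqueness of blow-ups (`IsBlowup.unique`) reduces to
`Bl_I Spec R = Proj R[It]`, covered by the charts `D₊(g_j t) = Spec R[I/g_j]`
(`affineBlowup.iSup_basicOpen_reesT_generators_eq_top`, `reesChartEquiv`), whose stalks are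
localisations (the `StalkOver` toolkit of `…OrbitBlowupCentreLocalLemmas.lean`).

## Sources

* The Stacks Project, Tag 0804. [StacksProject]
* U. Görtz, T. Wedhorn, *Algebraic Geometry I*, 2nd ed. (2020), (13.19), p. 413. [GortzWedhorn2020]
-/

set_option linter.dupNamespace false -- the tree's summit namespace repeats `ResolutionOfSingularities`

noncomputable section

open CategoryTheory CategoryTheory.Limits AlgebraicGeometry TopologicalSpace
open IsLocalRing
open Literature.AlgebraicGeometry.Resolution

namespace Summit.ResolutionOfSingularities.ResolutionOfSingularities.Theorems

set_option maxHeartbeats 2000000 in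
/-- **A point of a blow-up of `Spec R` along `(g₁, …, g_r)` lies on the chart of some `g_j`, with
local ring the localisation of `R[I/g_j]` at a prime `𝔮`** (maximal if the point is closed),
compatibly with the structure maps from `R` (uniqueness of blow-ups, the charts `D₊(g_j t)` of
`Bl_I Spec R` cover it, the chart ring is `R[I/g_j]`, stalks of `Spec` are localisations).
[cite: StacksProject, Tag 0804] -/
theorem chartsOverCentre_blowup_point_chart {R : Type} [CommRing R] {r : ℕ} (g : Fin r → R)
    {B : Scheme.{0}} (ρ₁ : B ⟶ Spec (.of R))
    (hB : IsBlowup ρ₁ (Scheme.IdealSheafData.ofIdealTop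
      ((Ideal.span (Set.range g)).map (Scheme.ΓSpecIso (.of R)).inv.hom)))
    (y : B) :
    ∃ (j : Fin r) (𝔮 : Ideal (blowupAlgebra (Ideal.span (Set.range g)) (g j))) (_ : 𝔮.IsPrime)
      (ε : StalkOver ρ₁ y ≃+* Localization.AtPrime 𝔮),
      (∀ a : R, ε (algebraMap R (StalkOver ρ₁ y) a) =
        algebraMap _ (Localization.AtPrime 𝔮) (algebraMap R (blowupAlgebra (Ideal.span (Set.range g)) (g j)) a)) ∧
      (IsClosed ({y} : Set B) → 𝔮.IsMaximal) := by
  classical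
  -- uniqueness of blow-ups: `B ≅ Bl_I Spec R`
  have hBl := affineBlowup.isBlowup (Ideal.span (Set.range g))
  obtain ⟨e, he, he'⟩ := hB.unique hBl
  -- the point lies on some chart `D₊(g_j t)`
  have hcov := affineBlowup.iSup_basicOpen_reesT_generators_eq_top g
  have hy₁ : e.hom.base y ∈ (⊤ : (affineBlowup (Ideal.span (Set.range g))).Opens) := trivial
  rw [← hcov, Opens.mem_iSup] at hy₁
  obtain ⟨j, hj⟩ := hy₁
  have hgj : g j ∈ Ideal.span (Set.range g) := Ideal.mem_span_range_self (f := g) (x := j)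
  rw [← affineBlowup.image_top_chartι (g j) hgj] at hj
  obtain ⟨y', -, hy'⟩ := hj
  change (affineBlowup.chartι (g j) hgj) y' = e.hom y at hy'
  -- the chart into `B`
  let gch := affineBlowup.chartι (I := Ideal.span (Set.range g)) (g j) hgj ≫ e.inv
  have hgch : gch ≫ ρ₁ = Spec.map (CommRingCat.ofHom (reesChartBase (g j) hgj)) := by
    rw [Category.assoc, he', affineBlowup.chartι_π]
  have hgchy : gch y' = y := by
    change e.inv (affineBlowup.chartι (g j) hgj y') = y
    rw [hy', ← Scheme.Hom.comp_apply, e.hom_inv_id]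
    rfl
  haveI : IsOpenImmersion gch := inferInstance
  -- the stalk of `B` at `y` is the stalk of the chart at `y'`
  let ι₁ : B.presheaf.stalk y ≅ (Spec (.of (HomogeneousLocalization.Away (reesGrading (Ideal.span (Set.range g)))
      (reesT (g j) hgj)))).presheaf.stalk y' :=
    (B.presheaf.stalkCongr (.of_eq hgchy.symm)) ≪≫ asIso (gch.stalkMap y')
  let ε₁ : StalkOver ρ₁ y ≃+* StalkOver (Spec.map (CommRingCat.ofHom (reesChartBase (g j) hgj))) y' :=
    ι₁.commRingCatIsoToRingEquiv
  have hε₁ : ∀ a : R, ε₁ (algebraMap R (StalkOver ρ₁ y) a) =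
      algebraMap R (StalkOver (Spec.map (CommRingCat.ofHom (reesChartBase (g j) hgj))) y') a := by
    intro a
    have h1 := stalkCongr_algebraMap_stalkOver ρ₁ hgchy.symm a
    have h2 := stalkMap_algebraMap_stalkOver gch _ ρ₁ hgch y' a
    rw [← h1] at h2
    rw [← h2]
    rfl
  -- the stalk of the chart is the localisation of the chart ring, then of `R[I/g_j]`
  obtain ⟨ε₂, hε₂⟩ := exists_stalk_ringEquiv_localization_specMap (reesChartBase (g j) hgj) y'
  let rcE := reesChartEquiv (I := Ideal.span (Set.range g)) (g j) hgj
  obtain ⟨ε₃, hε₃⟩ := exists_localization_ringEquiv_of_ringEquiv rcE.symm y'.asIdeal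
  let ε := ε₁.trans (ε₂.trans ε₃)
  refine ⟨j, _, _, ε, fun a => ?_, fun hyc => ?_⟩
  · change ε₃ (ε₂ (ε₁ _)) = _
    rw [hε₁, hε₂]
    have : reesChartBase (g j) hgj a = rcE.symm (algebraMap R _ a) := by
      rw [RingEquiv.eq_symm_apply]
      exact reesChartEquiv_reesChartBase (g j) hgj a
    exact (congrArg (fun t => ε₃ (algebraMap _ (Localization.AtPrime y'.asIdeal) t)) this).trans (hε₃ _)
  · -- `y'` is closed, so its prime is maximal
    have hy'c : IsClosed ({y'} : Set _) := by
      have : ({y'} : Set _) = gch.base ⁻¹' {y} := by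
        ext z
        simp only [Set.mem_singleton_iff, Set.mem_preimage]
        constructor
        · rintro rfl; exact hgchy
        · intro hz; exact gch.isOpenEmbedding.injective (hz.trans hgchy.symm)
      rw [this]
      exact hyc.preimage gch.continuous
    haveI := (PrimeSpectrum.isClosed_singleton_iff_isMaximal y').mp hy'c
    exact Ideal.comap_isMaximal_of_surjective _ rcE.symm.surjective

end Summit.ResolutionOfSingularities.ResolutionOfSingularities.Theorems

end
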